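import Literature.Computability.AlgebraicComplexity.VP0EmptyGateConstants
import Literature.Computability.AlgebraicComplexity.ConstantFreeDegree
import Literature.Computability.AlgebraicComplexity.PermanentVNP0
import Literature.Computability.AlgebraicComplexity.HamiltonianCycleVNP0
import Literature.Computability.AlgebraicComplexity.SkewCircuitFormalDegree
import HarnessLib

/-!
# The no-empty-gate `(size, formal degree)` calculus: `VP⁰` witnesses in the printed (fan-in-two) model

Bürgisser, *On defining integers …* (ECCC TR06-113 = Comput. Complexity 18 (2009)), §2.2 and
Def. 2.7–2.8: constant-free circuits have gates of fan-in EXACTLY two; inputs and constants have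
formal degree `1`; `VP⁰`/`VNP⁰` bound size and formal degree polynomially. The tree's classes
`IsVP0Family`/`IsVNP0Family` (`ConstantFreeValiant.lean`) use fan-in AT MOST two and give the
empty gates `Σ ∅`, `Π ∅` formal degree `0`, a strictly larger class (`VP0EmptyGateConstants.lean`:
`exists_isVP0Family_not_exactFanInTwo`; val-lit registry B41). This file supplies the bookkeeping
that upgrades the tree's MEMBERSHIP proofs to the printed model.

## What is here (all proved; one bookkeeping definition, no named facts)

* `ArithCircuit.forall_one_le_fanIn_add/_mul/_smul/_rename/_ofVar/_ofConst` — the circuit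
  combinators of `ArithCircuit.lean` never create an empty gate (`add`/`mul` append one binary
  gate, `smul` one unary gate, the leaves have no gates).
* `HasTauDeg₁ f s d` — the `(size, formal degree)` calculus `HasTauDeg` of
  `ConstantFreeDegree.lean` with the extra clause "every gate has at least one operand", and the
  same calculus lemmas (`X`, `C`, `one`, `zero`, `add`, `mul`, `neg`, `sub`, `one_sub`, `rename`,
  `finset_sum`, `finset_prod`, `two`, `pow`, `mono`, `totalDegree_le`); the bridges
  `HasTauDeg₁.hasTauDeg` (forget) and **`HasTauDeg₁.exists_exactFanInTwo`**: by the padding lemma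
  `ArithCircuit.exists_exactFanInTwo_of_forall_one_le_fanIn` a `HasTauDeg₁` witness is a circuit
  of Bürgisser's model — EVERY gate has exactly two operands — with the same value, sign
  constants, size `≤ s` and formal degree `≤ d`.
* Replays, verbatim in `HasTauDeg₁`, of the tree's two `VNP⁰` witnesses built with the calculus:
  the Ryser witness of the permanent (`hasTauDeg₁_perVNPSign/Cover/Witness`,
  **`exists_exactFanInTwo_perVNPWitness`**: size `≤ 2n² + 4n + 1`, formal degree `≤ 3n + 2`,
  `boolSum (perVNPWitness n ℤ) = perPoly (Fin n) ℤ` by `boolSum_perVNPWitness`) and the BCS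
  witness of the Hamiltonian cycle family (`hasTauDeg₁_hcVNPAlpha/Beta/Cover/Witness/Family`,
  **`exists_exactFanInTwo_hcVNPFamily`**). Hence `isVNP0Family_perPoly` and `isVNP0Family_hcPoly`
  hold in the printed, fan-in-exactly-two reading of `VNP⁰` as well (the statement-level
  consequence for BIJL 2018 Thm. 5, whose landed proof uses its hypothesis only at the
  permanent, is recorded in the val-lit memo `MEMO-B41-VP0-impact.md`, §1b).

Not replayed here: the Koiran witness of `KoiranCriterionWitness.lean` (same calculus, longer;
its downstream use is class-free) and the skew-circuit transfer `VP_s⁰ ⊆ VP⁰`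
(`SkewCircuitFormalDegree.lean`; there empty gates must be padded too, the formal degree being
re-bounded by skewness). Honest framing: bookkeeping about circuit models; nothing here bears on
`VP ≠ VNP`, which is NOT proved.

## References

* [Burgisser2006] P. Bürgisser, ECCC TR06-113 (2006) = Comput. Complexity 18 (2009), §2.2
  (fan-in two, formal degree), Def. 2.7 (`VP⁰`), Def. 2.8 (`VNP⁰`).
* [BurgisserClausenShokrollahi1997] Prop. (21.15), Rem. (21.16)(2) (the two witnesses).
* [BlaserIkenmeyerJindalLysikov2018] §6 (ECCC p. 17: "this set has a `VNP⁰`-natural proof,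
  namely the permanent itself"), App. A Def. 29.
* [Burgisser2000] Def. 2.1 (the list model `ArithCircuit` and its combinators).
-/

noncomputable section

namespace Literature.Computability.AlgebraicComplexity

open MvPolynomial

universe u v w

/-! ### No empty gates along the circuit combinators -/

namespace ArithCircuit

variable {k : Type u} {σ : Type v} {τ : Type w}

/-- Shifting gate references keeps the fan-in (twins: the private `fanIn_shift_aux` of
`ArithCircuitProofs.lean` and the Summits-side `Gate.fanIn_shift`, neither importable here). [folklore] -/
private theorem Gate.fanIn_shift_eq (n : ℕ) (g : Gate k σ) : (g.shift n).fanIn = g.fanIn := by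
  cases g <;> simp [Gate.shift, Gate.fanIn, Gate.args]

/-- Renaming variables keeps the fan-in (twin: `DepthThreeChasm.fanIn_rename` in
`DepthThreeChasmCircuits.lean`, kept out of this file's import cone). [folklore] -/
private theorem Gate.fanIn_rename_eq (e : σ → τ) (g : Gate k σ) : (g.rename e).fanIn = g.fanIn := by
  cases g <;> simp [Gate.rename, Gate.fanIn, Gate.args]

/-- `ofVar` has no gates at all. [cite: Burgisser2000, Def. 2.1] -/
theorem forall_one_le_fanIn_ofVar (i : σ) : ∀ g ∈ (ofVar i : ArithCircuit k σ).gates, 1 ≤ g.fanIn := by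
  simp [ofVar]

/-- `ofConst` has no gates at all. [cite: Burgisser2000, Def. 2.1] -/
theorem forall_one_le_fanIn_ofConst (c : k) :
    ∀ g ∈ (ofConst c : ArithCircuit k σ).gates, 1 ≤ g.fanIn := by
  simp [ofConst]

/-- The sum combinator adds one BINARY gate. [cite: Burgisser2000, Def. 2.1] -/
theorem forall_one_le_fanIn_add [CommSemiring k] {P Q : ArithCircuit k σ}
    (hP : ∀ g ∈ P.gates, 1 ≤ g.fanIn) (hQ : ∀ g ∈ Q.gates, 1 ≤ g.fanIn) :
    ∀ g ∈ (P.add Q).gates, 1 ≤ g.fanIn := by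
  intro g hg
  simp only [ArithCircuit.add, append, List.mem_append, List.mem_map, List.mem_singleton] at hg
  rcases hg with (hg | ⟨g0, hg0, rfl⟩) | rfl
  · exact hP g hg
  · rw [Gate.fanIn_shift_eq]; exact hQ g0 hg0
  · simp [Gate.fanIn, Gate.args]

/-- The product combinator adds one BINARY gate. [cite: Burgisser2000, Def. 2.1] -/
theorem forall_one_le_fanIn_mul [Zero k] {P Q : ArithCircuit k σ}
    (hP : ∀ g ∈ P.gates, 1 ≤ g.fanIn) (hQ : ∀ g ∈ Q.gates, 1 ≤ g.fanIn) :
    ∀ g ∈ (P.mul Q).gates, 1 ≤ g.fanIn := by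
  intro g hg
  simp only [ArithCircuit.mul, append, List.mem_append, List.mem_map, List.mem_singleton] at hg
  rcases hg with (hg | ⟨g0, hg0, rfl⟩) | rfl
  · exact hP g hg
  · rw [Gate.fanIn_shift_eq]; exact hQ g0 hg0
  · simp [Gate.fanIn, Gate.args]

/-- The scalar combinator adds one UNARY gate. [cite: Burgisser2000, Def. 2.1] -/
theorem forall_one_le_fanIn_smul {c : k} {P : ArithCircuit k σ} (hP : ∀ g ∈ P.gates, 1 ≤ g.fanIn) :
    ∀ g ∈ (P.smul c).gates, 1 ≤ g.fanIn := by
  intro g hg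
  simp only [ArithCircuit.smul, List.mem_append, List.mem_singleton] at hg
  rcases hg with hg | rfl
  · exact hP g hg
  · simp [Gate.fanIn, Gate.args]

/-- Renaming keeps the fan-ins. [cite: Burgisser2000, Def. 2.1] -/
theorem forall_one_le_fanIn_rename (e : σ → τ) {P : ArithCircuit k σ}
    (hP : ∀ g ∈ P.gates, 1 ≤ g.fanIn) : ∀ g ∈ (P.rename e).gates, 1 ≤ g.fanIn := by
  intro g hg
  simp only [ArithCircuit.rename, List.mem_map] at hg
  obtain ⟨g0, hg0, rfl⟩ := hg
  rw [Gate.fanIn_rename_eq]; exact hP g0 hg0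

end ArithCircuit

/-! ### The calculus `HasTauDeg₁`: `HasTauDeg` without empty gates -/

section TauDegOne

variable {σ : Type v} {τ : Type w}

open ArithCircuit

/-- `HasTauDeg₁ f s d`: `f` is computed by a constant-free (`HasSignConstants`) circuit of fan-in
at most two in which EVERY gate has at least one operand (no empty gates `Σ ∅`, `Π ∅`), of size
`≤ s` and formal degree `≤ d` — `HasTauDeg` (Bürgisser 2009, Def. 2.7 measures) with the empty
gates of the tree's list model excluded, so that (by padding) the circuit is one of Bürgisser's
fan-in-EXACTLY-two model with the same size and formal degree (`HasTauDeg₁.exists_exactFanInTwo`).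
[cite: Burgisser2006, Def. 2.7 and §2.2] -/
def HasTauDeg₁ (f : MvPolynomial σ ℤ) (s d : ℕ) : Prop :=
  ∃ P : ArithCircuit ℤ σ, P.IsFanInTwo ∧ (∀ g ∈ P.gates, 1 ≤ g.fanIn) ∧ P.HasSignConstants ∧
    P.eval = f ∧ P.size ≤ s ∧ P.formalDegree ≤ d

namespace HasTauDeg₁

/-- Forgetting the no-empty-gate clause. [cite: Burgisser2006, Def. 2.7] -/
theorem hasTauDeg {f : MvPolynomial σ ℤ} {s d : ℕ} (h : HasTauDeg₁ f s d) : HasTauDeg f s d := by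
  obtain ⟨P, h1, -, h3, h4, h5, h6⟩ := h
  exact ⟨P, h1, h3, h4, h5, h6⟩

/-- **Printed reading.** A `HasTauDeg₁` witness pads to a circuit of Bürgisser's model: every
gate has EXACTLY two operands, sign constants, the same value, size `≤ s` and formal degree `≤ d`
(`ArithCircuit.exists_exactFanInTwo_of_forall_one_le_fanIn`). [cite: Burgisser2006, Def. 2.7 and §2.2] -/
theorem exists_exactFanInTwo {f : MvPolynomial σ ℤ} {s d : ℕ} (h : HasTauDeg₁ f s d) :
    ∃ P : ArithCircuit ℤ σ, (∀ g ∈ P.gates, g.fanIn = 2) ∧ P.HasSignConstants ∧ P.eval = f ∧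
      P.size ≤ s ∧ P.formalDegree ≤ d := by
  obtain ⟨P, h1, h2, h3, h4, h5, h6⟩ := h
  obtain ⟨Q, hQ2, hQe, hQs, hQd, hQc⟩ := P.exists_exactFanInTwo_of_forall_one_le_fanIn h1 h2
  exact ⟨Q, hQ2, hQc h3, hQe.trans h4, hQs.le.trans h5, hQd.le.trans h6⟩

/-- Monotonicity in both bounds. [cite: Burgisser2006, Def. 2.7] -/
theorem mono {f : MvPolynomial σ ℤ} {s d s' d' : ℕ} (h : HasTauDeg₁ f s d) (hs : s ≤ s') (hd : d ≤ d') :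
    HasTauDeg₁ f s' d' := by
  obtain ⟨P, h1, h2, h3, h4, h5, h6⟩ := h
  exact ⟨P, h1, h2, h3, h4, h5.trans hs, h6.trans hd⟩

/-- Variables: size `0`, formal degree `1` (an input node, no gate). [cite: Burgisser2006, §2.2] -/
theorem X (i : σ) : HasTauDeg₁ (MvPolynomial.X i : MvPolynomial σ ℤ) 0 1 :=
  ⟨ofVar i, IsFanInTwo.ofVar i, forall_one_le_fanIn_ofVar i, HasSignConstants.ofVar i, rfl,
    le_rfl, le_rfl⟩

/-- Sign constants `c ∈ {0, 1, -1}`: size `0`, formal degree `1` (an input node, no gate — NOT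
the empty product). [cite: Burgisser2006, §2.2] -/
theorem C {c : ℤ} (hc : IsSignConstant c) : HasTauDeg₁ (MvPolynomial.C c : MvPolynomial σ ℤ) 0 1 :=
  ⟨ofConst c, IsFanInTwo.ofConst c, forall_one_le_fanIn_ofConst c,
    (hasSignConstants_ofConst_iff c).2 hc, rfl, le_rfl, le_rfl⟩

/-- `1` as the input constant `1`. [cite: Burgisser2006, §2.2] -/
theorem one : HasTauDeg₁ (1 : MvPolynomial σ ℤ) 0 1 := by
  simpa using C (σ := σ) isSignConstant_one

/-- `0` as the input constant `0`. [cite: Burgisser2006, §2.2] -/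
theorem zero : HasTauDeg₁ (0 : MvPolynomial σ ℤ) 0 1 := by
  simpa using C (σ := σ) isSignConstant_zero

/-- Sums: `(s₁ + s₂ + 1, max d₁ d₂)`, one binary gate. [cite: Burgisser2006, §2.2] -/
theorem add {f g : MvPolynomial σ ℤ} {s₁ d₁ s₂ d₂ : ℕ} (hf : HasTauDeg₁ f s₁ d₁)
    (hg : HasTauDeg₁ g s₂ d₂) : HasTauDeg₁ (f + g) (s₁ + s₂ + 1) (max d₁ d₂) := by
  obtain ⟨P, hP1, hP0, hP2, hP3, hP4, hP5⟩ := hf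
  obtain ⟨Q, hQ1, hQ0, hQ2, hQ3, hQ4, hQ5⟩ := hg
  refine ⟨P.add Q, hP1.add hQ1, forall_one_le_fanIn_add hP0 hQ0, hP2.add hQ2,
    by rw [add_eval, hP3, hQ3], ?_, ?_⟩
  · rw [size_add]; omega
  · rw [formalDegree_add]; exact max_le_max hP5 hQ5

/-- Products: `(s₁ + s₂ + 1, d₁ + d₂)`, one binary gate. [cite: Burgisser2006, §2.2] -/
theorem mul {f g : MvPolynomial σ ℤ} {s₁ d₁ s₂ d₂ : ℕ} (hf : HasTauDeg₁ f s₁ d₁)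
    (hg : HasTauDeg₁ g s₂ d₂) : HasTauDeg₁ (f * g) (s₁ + s₂ + 1) (d₁ + d₂) := by
  obtain ⟨P, hP1, hP0, hP2, hP3, hP4, hP5⟩ := hf
  obtain ⟨Q, hQ1, hQ0, hQ2, hQ3, hQ4, hQ5⟩ := hg
  refine ⟨P.mul Q, hP1.mul hQ1, forall_one_le_fanIn_mul hP0 hQ0, hP2.mul hQ2,
    by rw [mul_eval, hP3, hQ3], ?_, ?_⟩
  · rw [size_mul]; omega
  · rw [formalDegree_mul]; exact Nat.add_le_add hP5 hQ5

/-- Negation: `(s + 1, d)`, one unary sum gate with coefficient `-1`. [cite: Burgisser2006, §2.2] -/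
theorem neg {f : MvPolynomial σ ℤ} {s d : ℕ} (hf : HasTauDeg₁ f s d) : HasTauDeg₁ (-f) (s + 1) d := by
  obtain ⟨P, hP1, hP0, hP2, hP3, hP4, hP5⟩ := hf
  refine ⟨P.smul (-1), hP1.smul, forall_one_le_fanIn_smul hP0, hP2.smul isSignConstant_neg_one,
    ?_, ?_, ?_⟩
  · rw [eval_smul, hP3, neg_one_smul]
  · rw [size_smul]; omega
  · rw [formalDegree_smul]; exact hP5

/-- Differences: `(s₁ + s₂ + 2, max d₁ d₂)`. [cite: Burgisser2006, §2.2] -/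
theorem sub {f g : MvPolynomial σ ℤ} {s₁ d₁ s₂ d₂ : ℕ} (hf : HasTauDeg₁ f s₁ d₁)
    (hg : HasTauDeg₁ g s₂ d₂) : HasTauDeg₁ (f - g) (s₁ + s₂ + 2) (max d₁ d₂) := by
  have h := hf.add hg.neg
  rw [← sub_eq_add_neg] at h
  exact h.mono (by omega) le_rfl

/-- `1 - f`: `(s + 2, max 1 d)`. [cite: Burgisser2006, §2.2] -/
theorem one_sub {f : MvPolynomial σ ℤ} {s d : ℕ} (hf : HasTauDeg₁ f s d) :
    HasTauDeg₁ (1 - f) (s + 2) (max 1 d) := by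
  simpa using one.sub hf

/-- Renaming variables keeps size, formal degree and fan-ins. [cite: Burgisser2006, §2.2] -/
theorem rename {f : MvPolynomial σ ℤ} {s d : ℕ} (hf : HasTauDeg₁ f s d) (e : σ → τ) :
    HasTauDeg₁ (MvPolynomial.rename e f) s d := by
  obtain ⟨P, hP1, hP0, hP2, hP3, hP4, hP5⟩ := hf
  refine ⟨P.rename e, hP1.rename e, forall_one_le_fanIn_rename e hP0, hP2.rename e, ?_,
    by rw [size_rename]; exact hP4, by rw [formalDegree_rename]; exact hP5⟩
  rw [eval_rename_apply, hP3]

/-- Finite sums with uniform bounds: size `≤ ∑ sᵢ + |t|`, formal degree `≤ max 1 d`.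
[cite: Burgisser2006, §2.2] -/
theorem finset_sum {ι : Type*} (t : Finset ι) {f : ι → MvPolynomial σ ℤ} {s : ι → ℕ} {d : ℕ}
    (h : ∀ i ∈ t, HasTauDeg₁ (f i) (s i) d) :
    HasTauDeg₁ (∑ i ∈ t, f i) (∑ i ∈ t, s i + t.card) (max 1 d) := by
  classical
  induction t using Finset.induction_on with
  | empty => simpa using (zero (σ := σ)).mono le_rfl (le_max_left 1 d)
  | insert a t ha ih =>
    rw [Finset.sum_insert ha, Finset.sum_insert ha, Finset.card_insert_of_notMem ha]
    have h1 := (h a (Finset.mem_insert_self a t)).add (ih fun i hi => h i (Finset.mem_insert_of_mem hi))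
    exact h1.mono (by omega) (by omega)

/-- Finite products with uniform bounds: size `≤ ∑ sᵢ + |t|`, formal degree `≤ |t|·d + 1`.
[cite: Burgisser2006, §2.2] -/
theorem finset_prod {ι : Type*} (t : Finset ι) {f : ι → MvPolynomial σ ℤ} {s : ι → ℕ} {d : ℕ}
    (h : ∀ i ∈ t, HasTauDeg₁ (f i) (s i) d) :
    HasTauDeg₁ (∏ i ∈ t, f i) (∑ i ∈ t, s i + t.card) (t.card * d + 1) := by
  classical
  induction t using Finset.induction_on with
  | empty => simpa using one (σ := σ)
  | insert a t ha ih =>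
    rw [Finset.prod_insert ha, Finset.sum_insert ha, Finset.card_insert_of_notMem ha]
    have h1 := (h a (Finset.mem_insert_self a t)).mul (ih fun i hi => h i (Finset.mem_insert_of_mem hi))
    refine h1.mono (by omega) ?_
    rw [add_mul, one_mul]; omega

/-- `2 = 1 + 1`: `(1, 1)`. [cite: Burgisser2006, §2.2] -/
theorem two : HasTauDeg₁ (2 : MvPolynomial σ ℤ) 1 1 := by
  have h := one.add (one (σ := σ))
  rw [one_add_one_eq_two] at h
  simpa using h

/-- Powers by iterated multiplication: `f ^ m` has `(m s + m, m d + 1)`. [cite: Burgisser2006, §2.2] -/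
theorem pow {f : MvPolynomial σ ℤ} {s d : ℕ} (hf : HasTauDeg₁ f s d) (m : ℕ) :
    HasTauDeg₁ (f ^ m) (m * s + m) (m * d + 1) := by
  induction m with
  | zero => simpa using one (σ := σ)
  | succ m ih =>
    rw [pow_succ]
    refine (ih.mul hf).mono ?_ ?_
    · rw [Nat.succ_mul]; omega
    · rw [Nat.succ_mul]; omega

/-- The degree bound: `deg f ≤ d`. [cite: Burgisser2006, §2.2] -/
theorem totalDegree_le {f : MvPolynomial σ ℤ} {s d : ℕ} (h : HasTauDeg₁ f s d) : f.totalDegree ≤ d := by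
  obtain ⟨P, -, -, -, h4, -, h6⟩ := h
  rw [← h4]
  exact P.totalDegree_eval_le_formalDegree.trans h6

end HasTauDeg₁

end TauDegOne

/-! ### Replay: the Ryser witness of `PER ∈ VNP⁰` in the printed (fan-in exactly two) model -/

section Permanent

/-- The sign selector `∏_j (Y_j + Y_j − 1)`: `(3n, n + 1)` without empty gates (replay of
`hasTauDeg_perVNPSign`). [cite: BurgisserClausenShokrollahi1997, Prop. (21.15)] -/
theorem hasTauDeg₁_perVNPSign (n : ℕ) : HasTauDeg₁ (perVNPSign n ℤ) (3 * n) (n + 1) := by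
  unfold perVNPSign
  have h : ∀ j ∈ (Finset.univ : Finset (Fin n)),
      HasTauDeg₁ ((X (Sum.inr j) + X (Sum.inr j) + C (-1) :
        MvPolynomial ((Fin n × Fin n) ⊕ Fin n) ℤ)) 2 1 := by
    intro j _
    have h1 := ((HasTauDeg₁.X (σ := (Fin n × Fin n) ⊕ Fin n) (Sum.inr j)).add
      (HasTauDeg₁.X (Sum.inr j))).add (HasTauDeg₁.C ArithCircuit.isSignConstant_neg_one)
    exact h1.mono (by omega) (by omega)
  refine (HasTauDeg₁.finset_prod _ h).mono ?_ ?_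
  · simp; omega
  · simp

/-- The cover polynomial `∏_i ∑_j Y_j X_{ji}`: `(2n² + n, 2n + 1)` without empty gates (replay of
`hasTauDeg_perVNPCover`). [cite: BurgisserClausenShokrollahi1997, Prop. (21.15)] -/
theorem hasTauDeg₁_perVNPCover (n : ℕ) :
    HasTauDeg₁ (perVNPCover n ℤ) (2 * n * n + n) (2 * n + 1) := by
  unfold perVNPCover
  have hterm : ∀ (i j : Fin n), HasTauDeg₁ ((X (Sum.inr j) * X (Sum.inl (j, i)) :
      MvPolynomial ((Fin n × Fin n) ⊕ Fin n) ℤ)) 1 2 := by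
    intro i j
    have h1 := (HasTauDeg₁.X (σ := (Fin n × Fin n) ⊕ Fin n) (Sum.inr j)).mul
      (HasTauDeg₁.X (Sum.inl (j, i)))
    exact h1.mono (by omega) (by omega)
  have hrow : ∀ i ∈ (Finset.univ : Finset (Fin n)),
      HasTauDeg₁ (∑ j : Fin n, (X (Sum.inr j) * X (Sum.inl (j, i)) :
        MvPolynomial ((Fin n × Fin n) ⊕ Fin n) ℤ)) (2 * n) 2 := by
    intro i _
    refine (HasTauDeg₁.finset_sum _ fun j _ => hterm i j).mono ?_ ?_
    · simp; omega
    · simp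
  refine (HasTauDeg₁.finset_prod _ hrow).mono ?_ ?_
  · simp; ring_nf; omega
  · simp; omega

/-- The Ryser witness: `(2n² + 4n + 1, 3n + 2)` without empty gates (replay of
`hasTauDeg_perVNPWitness`). [cite: BurgisserClausenShokrollahi1997, Prop. (21.15)] -/
theorem hasTauDeg₁_perVNPWitness (n : ℕ) :
    HasTauDeg₁ (perVNPWitness n ℤ) (2 * n * n + 4 * n + 1) (3 * n + 2) := by
  unfold perVNPWitness
  exact ((hasTauDeg₁_perVNPSign n).mul (hasTauDeg₁_perVNPCover n)).mono (by omega) (by omega)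

/-- **The Ryser witness in Bürgisser's printed model.** For every `n` the `VNP⁰` witness
`perVNPWitness n ℤ` of the permanent (`boolSum (perVNPWitness n ℤ) = perPoly (Fin n) ℤ`,
`boolSum_perVNPWitness`) is computed by a constant-free circuit in which EVERY gate has EXACTLY
two operands, of size `≤ 2n² + 4n + 1` and formal degree `≤ 3n + 2` — so the tree's membership
`isVNP0Family_perPoly` (stated for the larger tree class `IsVNP0Family`, fan-in at most two) also
holds in the printed, fan-in-exactly-two reading of `VNP⁰` (Bürgisser 2009, Def. 2.7–2.8; BIJL
2018, Def. 29 and §6 "this set has a `VNP⁰`-natural proof, namely the permanent itself").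
[cite: Burgisser2006, Def. 2.7 and Def. 2.8] [cite: BlaserIkenmeyerJindalLysikov2018, §6 (p. 17) and Def. 29]
[cite: BurgisserClausenShokrollahi1997, Prop. (21.15)] -/
theorem exists_exactFanInTwo_perVNPWitness (n : ℕ) :
    ∃ P : ArithCircuit ℤ ((Fin n × Fin n) ⊕ Fin n), (∀ g ∈ P.gates, g.fanIn = 2) ∧
      P.HasSignConstants ∧ P.eval = perVNPWitness n ℤ ∧ P.size ≤ 2 * n * n + 4 * n + 1 ∧
      P.formalDegree ≤ 3 * n + 2 :=
  (hasTauDeg₁_perVNPWitness n).exists_exactFanInTwo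

end Permanent

/-! ### Replay: the `VNP⁰` witness of the Hamiltonian cycle family in the printed model -/

section HamiltonianCycle


/-- BCS's `α` (product over the `≤ n⁴` conflicting pairs of `1 - Z_p Z_q`): size `≤ 4 n^4`,
formal degree `≤ 2 n^4 + 1` (`n = m + 2`). No empty gates (replay in `HasTauDeg₁`). [cite: BurgisserClausenShokrollahi1997, Prop. (21.15)] -/
theorem hasTauDeg₁_hcVNPAlpha (m : ℕ) :
    HasTauDeg₁ (hcVNPAlpha m ℤ) (4 * (m + 2) ^ 4) (2 * (m + 2) ^ 4 + 1) := by
  unfold hcVNPAlpha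
  have hterm : ∀ pq ∈ conflictPairs (m + 2),
      HasTauDeg₁ ((1 - X (Sum.inr (finProdFinEquiv pq.1)) * X (Sum.inr (finProdFinEquiv pq.2)) :
        MvPolynomial (HCVars m) ℤ)) 3 2 := by
    intro pq _
    have h := ((HasTauDeg₁.X (σ := HCVars m) (Sum.inr (finProdFinEquiv pq.1))).mul
      (HasTauDeg₁.X (Sum.inr (finProdFinEquiv pq.2)))).one_sub
    exact h.mono (by omega) (by simp)
  have hcard := card_conflictPairs_le (m + 2)
  refine (HasTauDeg₁.finset_prod _ hterm).mono ?_ ?_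
  · simp only [Finset.sum_const, smul_eq_mul]
    nlinarith
  · nlinarith

/-- BCS's `β = ∏_t ∑_i Z_{(t,i)}`: size `≤ n² + n`, formal degree `≤ n + 1`.
No empty gates (replay in `HasTauDeg₁`). [cite: BurgisserClausenShokrollahi1997, Prop. (21.15)] -/
theorem hasTauDeg₁_hcVNPBeta (m : ℕ) :
    HasTauDeg₁ (hcVNPBeta m ℤ) ((m + 2) * (m + 2) + (m + 2)) ((m + 2) + 1) := by
  unfold hcVNPBeta
  have hrow : ∀ t ∈ (Finset.univ : Finset (Fin (m + 2))),
      HasTauDeg₁ (∑ i : Fin (m + 2), (X (Sum.inr (finProdFinEquiv (t, i))) :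
        MvPolynomial (HCVars m) ℤ)) (m + 2) 1 := by
    intro t _
    refine (HasTauDeg₁.finset_sum _ fun i _ =>
      HasTauDeg₁.X (σ := HCVars m) (Sum.inr (finProdFinEquiv (t, i)))).mono ?_ ?_
    · simp
    · simp
  refine (HasTauDeg₁.finset_prod _ hrow).mono ?_ ?_
  · simp
  · simp

/-- The cover product `∏_t ∑_{i,j} Z_{(t,i)} Z_{(t+1,j)} X_{(j,i)}`: size `≤ 3n³ + n² + n`, formal
degree `≤ 3n + 1`. No empty gates (replay in `HasTauDeg₁`). [cite: BurgisserClausenShokrollahi1997, Prop. (21.15)] -/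
theorem hasTauDeg₁_hcVNPCover (m : ℕ) :
    HasTauDeg₁ (hcVNPCover m ℤ)
      ((m + 2) * (3 * (m + 2) * (m + 2) + (m + 2)) + (m + 2)) ((m + 2) * 3 + 1) := by
  unfold hcVNPCover
  have hterm : ∀ (t i j : Fin (m + 2)),
      HasTauDeg₁ ((X (Sum.inr (finProdFinEquiv (t, i))) *
          X (Sum.inr (finProdFinEquiv (finRotate (m + 2) t, j))) * X (Sum.inl (j, i)) :
        MvPolynomial (HCVars m) ℤ)) 2 3 := by
    intro t i j
    have h := ((HasTauDeg₁.X (σ := HCVars m) (Sum.inr (finProdFinEquiv (t, i)))).mul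
      (HasTauDeg₁.X (Sum.inr (finProdFinEquiv (finRotate (m + 2) t, j))))).mul
      (HasTauDeg₁.X (Sum.inl (j, i)))
    exact h.mono (by omega) (by omega)
  have hj : ∀ (t i : Fin (m + 2)),
      HasTauDeg₁ (∑ j : Fin (m + 2), (X (Sum.inr (finProdFinEquiv (t, i))) *
          X (Sum.inr (finProdFinEquiv (finRotate (m + 2) t, j))) * X (Sum.inl (j, i)) :
        MvPolynomial (HCVars m) ℤ)) (3 * (m + 2)) 3 := by
    intro t i
    refine (HasTauDeg₁.finset_sum _ fun j _ => hterm t i j).mono ?_ ?_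
    · simp; omega
    · simp
  have hi : ∀ t ∈ (Finset.univ : Finset (Fin (m + 2))),
      HasTauDeg₁ (∑ i : Fin (m + 2), ∑ j : Fin (m + 2), (X (Sum.inr (finProdFinEquiv (t, i))) *
          X (Sum.inr (finProdFinEquiv (finRotate (m + 2) t, j))) * X (Sum.inl (j, i)) :
        MvPolynomial (HCVars m) ℤ)) (3 * (m + 2) * (m + 2) + (m + 2)) 3 := by
    intro t _
    refine (HasTauDeg₁.finset_sum _ fun i _ => hj t i).mono ?_ ?_
    · simp; ring_nf; omega
    · simp
  refine (HasTauDeg₁.finset_prod _ hi).mono ?_ ?_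
  · simp
  · simp

/-- **The witness `G_{m+2}` is constant-free cheap**: size `≤ 9 (m+2)^4`, formal degree
`≤ 3 (m+2)^4`. No empty gates (replay in `HasTauDeg₁`). [cite: BurgisserClausenShokrollahi1997, Prop. (21.15)] -/
theorem hasTauDeg₁_hcVNPWitness (m : ℕ) :
    HasTauDeg₁ (hcVNPWitness m ℤ) (9 * (m + 2) ^ 4) (3 * (m + 2) ^ 4) := by
  unfold hcVNPWitness
  have h := ((hasTauDeg₁_hcVNPAlpha m).mul (hasTauDeg₁_hcVNPBeta m)).mul
    ((HasTauDeg₁.X (σ := HCVars m)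
      (Sum.inr (finProdFinEquiv ((0 : Fin (m + 2)), (0 : Fin (m + 2)))))).mul
      (hasTauDeg₁_hcVNPCover m))
  refine h.mono ?_ ?_
  · ring_nf; omega
  · ring_nf; omega

/-- Uniform bounds for the whole family (`0` for `n ≤ 1`): size `≤ 9 n^4`, formal degree
`≤ 3 n^4 + 1`; no empty gates. [cite: BurgisserClausenShokrollahi1997, Prop. (21.15)] -/
theorem hasTauDeg₁_hcVNPFamily (n : ℕ) :
    HasTauDeg₁ (hcVNPFamily ℤ n) (9 * n ^ 4) (3 * n ^ 4 + 1) := by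
  match n with
  | 0 => exact HasTauDeg₁.zero.mono (Nat.zero_le _) (by norm_num)
  | 1 => exact HasTauDeg₁.zero.mono (Nat.zero_le _) (by norm_num)
  | m + 2 => exact (hasTauDeg₁_hcVNPWitness m).mono le_rfl (Nat.le_succ _)

/-- **The Hamiltonian-cycle `VNP⁰` witness in Bürgisser's printed model**: for every `n` the
witness `hcVNPFamily ℤ n` (`isVNP0Family_hcPoly`'s Boolean-sum integrand) is computed by a
constant-free circuit in which every gate has EXACTLY two operands, of size `≤ 9n⁴` and formal
degree `≤ 3n⁴ + 1` — the tree's `isVP0Family_hcVNPFamily` / `isVNP0Family_hcPoly` hold in the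
fan-in-exactly-two reading. [cite: Burgisser2006, Def. 2.7 and Def. 2.8]
[cite: BurgisserClausenShokrollahi1997, Prop. (21.15)] -/
theorem exists_exactFanInTwo_hcVNPFamily (n : ℕ) :
    ∃ P : ArithCircuit ℤ ((Fin n × Fin n) ⊕ Fin (n * n)), (∀ g ∈ P.gates, g.fanIn = 2) ∧
      P.HasSignConstants ∧ P.eval = hcVNPFamily ℤ n ∧ P.size ≤ 9 * n ^ 4 ∧
      P.formalDegree ≤ 3 * n ^ 4 + 1 :=
  (hasTauDeg₁_hcVNPFamily n).exists_exactFanInTwo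

end HamiltonianCycle

/-! ### Padding ALL degenerate gates (skew circuits): `pad₀` -/

namespace ArithCircuit

variable {k : Type u} [CommSemiring k] {σ : Type v}

/-- Pad every gate of fan-in `≤ 1` to fan-in two, INCLUDING the empty gates: `Σ ∅ ↦ 0•0 + 0•0`,
`Π ∅ ↦ 1•1 + 0•1`, `a • u ↦ a • u + 0 • u`, `Π [u] ↦ 1 • u + 0 • u`. Value and sign constants are
preserved and every padded gate is a (skew) sum gate; the formal degree may GROW (the empty
gates pass from `0` to `1`) — for skew circuits it is re-bounded by the size.
[cite: Burgisser2006, §2.2] [cite: HuttenhainIkenmeyer2016, §5] -/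
def Gate.pad₀ : Gate k σ → Gate k σ
  | .sum [] => .sum [(0, .const 0), (0, .const 0)]
  | .sum [a] => .sum [a, (0, a.2)]
  | .prod [] => .sum [(1, .const 1), (0, .const 1)]
  | .prod [u] => .sum [(1, u), (0, u)]
  | g => g

/-- `pad₀` does not change the value. [cite: Burgisser2000, Def. 2.1] -/
theorem Gate.eval_pad₀ (vals : List (MvPolynomial σ k)) (g : Gate k σ) :
    g.pad₀.eval vals = g.eval vals := by
  rcases g with args | args
  · rcases args with _ | ⟨a, _ | ⟨b, l⟩⟩ <;> simp [Gate.pad₀, Gate.eval]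
  · rcases args with _ | ⟨u, _ | ⟨w, l⟩⟩ <;> simp [Gate.pad₀, Gate.eval, Operand.eval]

/-- A `pad₀`-padded gate of fan-in `≤ 2` has fan-in exactly `2`. [cite: Burgisser2006, §2.2] -/
theorem Gate.fanIn_pad₀ {g : Gate k σ} (h2 : g.fanIn ≤ 2) : g.pad₀.fanIn = 2 := by
  rcases g with args | args
  · rcases args with _ | ⟨a, _ | ⟨b, _ | ⟨c, l⟩⟩⟩ <;> simp_all [Gate.pad₀, Gate.fanIn, Gate.args]
  · rcases args with _ | ⟨u, _ | ⟨w, _ | ⟨c, l⟩⟩⟩ <;> simp_all [Gate.pad₀, Gate.fanIn, Gate.args]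

/-- `pad₀` preserves sign constants (new coefficients `0`, `1`; new constants `0`, `1`).
[cite: Burgisser2000, §1.4] -/
theorem Gate.hasSignConstants_pad₀ {g : Gate k σ} (hg : g.HasSignConstants) :
    g.pad₀.HasSignConstants := by
  rcases g with args | args
  · rcases args with _ | ⟨a, _ | ⟨b, l⟩⟩
    · simp [Gate.pad₀, Gate.HasSignConstants, Operand.HasSignConstants, IsSignConstant]
    · simp only [Gate.pad₀, Gate.HasSignConstants, List.mem_cons, List.mem_nil_iff, or_false,
        forall_eq_or_imp, forall_eq]
      simp only [Gate.HasSignConstants, List.mem_singleton, forall_eq] at hg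
      exact ⟨hg, Or.inl rfl, hg.2⟩
    · exact hg
  · rcases args with _ | ⟨u, _ | ⟨w, l⟩⟩
    · simp [Gate.pad₀, Gate.HasSignConstants, Operand.HasSignConstants, IsSignConstant]
    · simp only [Gate.pad₀, Gate.HasSignConstants, List.mem_cons, List.mem_nil_iff, or_false,
        forall_eq_or_imp, forall_eq]
      simp only [Gate.HasSignConstants, List.mem_singleton, forall_eq] at hg
      exact ⟨⟨Or.inr (Or.inl rfl), hg⟩, Or.inl rfl, hg⟩
    · exact hg

/-- `pad₀` preserves skewness (every new gate is a sum gate). [cite: HuttenhainIkenmeyer2016, §5] -/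
theorem Gate.isSkew_pad₀ {g : Gate k σ} (hg : g.IsSkew) : g.pad₀.IsSkew := by
  rcases g with args | args
  · rcases args with _ | ⟨a, _ | ⟨b, l⟩⟩ <;> simp [Gate.pad₀, Gate.IsSkew]
  · rcases args with _ | ⟨u, _ | ⟨w, l⟩⟩
    · simp [Gate.pad₀, Gate.IsSkew]
    · simp [Gate.pad₀, Gate.IsSkew]
    · exact hg

/-- `pad₀` on every gate does not change the value list. [cite: Burgisser2000, Def. 2.1] -/
theorem gateValues_map_pad₀ (gs : List (Gate k σ)) :
    gateValues (gs.map Gate.pad₀) = gateValues gs := by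
  induction gs using List.reverseRecOn with
  | nil => rfl
  | append_singleton gs g ih =>
    rw [List.map_append, List.map_singleton, gateValues_append_singleton,
      gateValues_append_singleton, ih, Gate.eval_pad₀]

/-- **Skew circuits in the printed model.** A fan-in-two skew circuit (possibly with empty or
unary gates) becomes, by `pad₀`, a skew circuit in which every gate has exactly two operands,
with the same value and size, sign constants kept, and formal degree `≤ size + 1` (re-bounded by
skewness, `formalDegree_le_size_succ_of_isSkew`). [cite: HuttenhainIkenmeyer2016, §5]
[cite: Burgisser2006, §2.2 and Def. 2.7] -/
theorem exists_exactFanInTwo_of_isSkew (P : ArithCircuit k σ) (h2 : P.IsFanInTwo) (hs : P.IsSkew) :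
    ∃ Q : ArithCircuit k σ, (∀ g ∈ Q.gates, g.fanIn = 2) ∧ Q.IsSkew ∧ Q.eval = P.eval ∧
      Q.size = P.size ∧ Q.formalDegree ≤ P.size + 1 ∧
      (P.HasSignConstants → Q.HasSignConstants) := by
  set Q : ArithCircuit k σ := ⟨P.gates.map Gate.pad₀, P.output⟩ with hQ
  have hfan : ∀ g ∈ Q.gates, g.fanIn = 2 := by
    intro g hg
    obtain ⟨g', hg', rfl⟩ := List.mem_map.1 hg
    exact Gate.fanIn_pad₀ (h2 g' hg')
  have hskew : Q.IsSkew := by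
    intro g hg
    obtain ⟨g', hg', rfl⟩ := List.mem_map.1 hg
    exact Gate.isSkew_pad₀ (hs g' hg')
  have hsize : Q.size = P.size := by simp [hQ, ArithCircuit.size]
  refine ⟨Q, hfan, hskew, ?_, hsize, ?_, fun hsc => ⟨fun g hg => ?_, hsc.2⟩⟩
  · simp only [hQ, ArithCircuit.eval, gateValues_map_pad₀]
  · rw [← hsize]
    exact formalDegree_le_size_succ_of_isSkew Q (fun g hg => (hfan g hg).le) hskew
  · obtain ⟨g', hg', rfl⟩ := List.mem_map.1 hg
    exact Gate.hasSignConstants_pad₀ (hsc.1 g' hg')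

end ArithCircuit

/-! ### The printed classes `VP⁰`, `VNP⁰` (fan-in exactly two) next to the tree's -/

section ExactClasses

variable {σ : ℕ → Type v} {τ : ℕ → Type w} [∀ n, Fintype (σ n)] [∀ n, Fintype (τ n)]

/-- **`VP⁰` as printed** (Bürgisser 2009, Def. 2.7; BIJL 2018, App. A Def. 29): `f = (f_n)` is
computed by constant-free (`HasSignConstants`) circuits in which EVERY gate has EXACTLY two
operands ("all nodes except the input nodes have fan-in 2"; input nodes — variables and the
constants — have formal degree `1`, which is the tree's `ArithCircuit.formalDegree`), of
p-bounded size and formal degree, in p-boundedly many variables. Compare the tree's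
`IsVP0Family` (fan-in AT MOST two), a strictly larger class (`exists_isVP0Family_not_exactFanInTwo`).
[cite: Burgisser2006, Def. 2.7 and §2.2] [cite: BlaserIkenmeyerJindalLysikov2018, Def. 29] -/
def IsExactVP0Family (f : ∀ n, MvPolynomial (σ n) ℤ) : Prop :=
  IsPBounded (fun n => Fintype.card (σ n)) ∧
    ∃ C : ∀ n, ArithCircuit ℤ (σ n),
      (∀ n, (∀ g ∈ (C n).gates, g.fanIn = 2) ∧ (C n).HasSignConstants ∧ (C n).Computes (f n)) ∧
        IsPBounded (fun n => (C n).size) ∧ IsPBounded fun n => (C n).formalDegree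

/-- **`VNP⁰` as printed** (Bürgisser 2009, Def. 2.8; BIJL 2018, Def. 29): a Boolean sum
`f_n = ∑_{e ∈ {0,1}^{u n}} g_n(X, e)` of a printed-`VP⁰` family `g`. [cite: Burgisser2006, Def. 2.8]
[cite: BlaserIkenmeyerJindalLysikov2018, Def. 29] -/
def IsExactVNP0Family (f : ∀ n, MvPolynomial (σ n) ℤ) : Prop :=
  ∃ (u : ℕ → ℕ) (g : ∀ n, MvPolynomial (σ n ⊕ Fin (u n)) ℤ),
    IsExactVP0Family g ∧ ∀ n, f n = boolSum (g n)

/-- Printed `VP⁰` ⊆ tree `VP⁰` (fan-in exactly two is fan-in at most two).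
[cite: Burgisser2006, Def. 2.7] -/
theorem IsExactVP0Family.isVP0Family {f : ∀ n, MvPolynomial (σ n) ℤ} (hf : IsExactVP0Family f) :
    IsVP0Family f := by
  obtain ⟨hσ, C, hC, hs, hd⟩ := hf
  exact ⟨hσ, C, fun n => ⟨fun g hg => ((hC n).1 g hg).le, (hC n).2.1, (hC n).2.2⟩, hs, hd⟩

/-- Printed `VNP⁰` ⊆ tree `VNP⁰`. [cite: Burgisser2006, Def. 2.8] -/
theorem IsExactVNP0Family.isVNP0Family {f : ∀ n, MvPolynomial (σ n) ℤ}
    (hf : IsExactVNP0Family f) : IsVNP0Family f := by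
  obtain ⟨u, g, hg, hfg⟩ := hf
  exact ⟨u, g, hg.isVP0Family, hfg⟩

/-- **Printed `VP⁰` membership from the no-empty-gate calculus.** [cite: Burgisser2006, Def. 2.7] -/
theorem IsExactVP0Family.of_hasTauDeg₁ {f : ∀ n, MvPolynomial (σ n) ℤ}
    (hσ : IsPBounded fun n => Fintype.card (σ n)) {s d : ℕ → ℕ} (hs : IsPBounded s)
    (hd : IsPBounded d) (h : ∀ n, HasTauDeg₁ (f n) (s n) (d n)) : IsExactVP0Family f := by
  have h' := fun n => (h n).exists_exactFanInTwo
  choose P h1 h2 h3 h4 h5 using h'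
  exact ⟨hσ, P, fun n => ⟨h1 n, h2 n, h3 n⟩, hs.mono fun n => h4 n, hd.mono fun n => h5 n⟩

/-- **`VP_s⁰ ⊆ VP⁰` in the printed model**: a family of constant-free fan-in-two SKEW circuits
of p-bounded size (the tree's `IsVPsZeroFamily`, which also tolerates empty gates) is a printed
`VP⁰` family: `pad₀` all degenerate gates and re-bound the formal degree by skewness
(`ArithCircuit.exists_exactFanInTwo_of_isSkew`; cf. `IsVPsZeroFamily.isVP0Family`).
[cite: HuttenhainIkenmeyer2016, §5] [cite: Burgisser2006, Def. 2.7] -/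
theorem IsVPsZeroFamily.isExactVP0Family {f : ∀ n, MvPolynomial (σ n) ℤ}
    (hf : IsVPsZeroFamily f) (hσ : IsPBounded fun n => Fintype.card (σ n)) :
    IsExactVP0Family f := by
  obtain ⟨P, hP, hsize⟩ := hf
  have h := fun n => (P n).exists_exactFanInTwo_of_isSkew (hP n).1 (hP n).2.2.1
  choose Q hQ2 hQsk hQe hQs hQd hQc using h
  refine ⟨hσ, Q, fun n => ⟨hQ2 n, hQc n (hP n).2.1, ?_⟩, hsize.mono fun n => (hQs n).le,
    (IsPBounded.add_holds hsize (IsPBounded.const 1)).mono fun n => hQd n⟩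
  rw [ArithCircuit.Computes, hQe n]
  exact (hP n).2.2.2

end ExactClasses

/-! ### The memberships in the printed model -/

section Memberships

/-- **The Ryser witness family is in printed `VP⁰`** (cf. `isVP0Family_perVNPWitness`).
[cite: Burgisser2006, Def. 2.7] [cite: BurgisserClausenShokrollahi1997, Prop. (21.15)] -/
theorem isExactVP0Family_perVNPWitness :
    IsExactVP0Family (σ := fun n => (Fin n × Fin n) ⊕ Fin n) fun n => perVNPWitness n ℤ := by
  refine IsExactVP0Family.of_hasTauDeg₁ ?_ (s := fun n => 2 * n * n + 4 * n + 1)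
    (d := fun n => 3 * n + 2) ?_ ?_ hasTauDeg₁_perVNPWitness
  · refine (IsPBounded.iff_exists_le_mul_succ_pow _).2 ⟨1, 2, fun n => ?_⟩
    have e : 1 * (n + 1) ^ 2 = n * n + 2 * n + 1 := by ring
    simp only [Fintype.card_sum, Fintype.card_prod, Fintype.card_fin]
    omega
  · refine (IsPBounded.iff_exists_le_mul_succ_pow _).2 ⟨4, 2, fun n => ?_⟩
    have e : 4 * (n + 1) ^ 2 = 4 * n * n + 8 * n + 4 := by ring
    rw [e]; nlinarith
  · exact (IsPBounded.iff_exists_le_mul_succ_pow _).2 ⟨3, 1, fun n => by rw [pow_one]; omega⟩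

/-- **`PER ∈ VNP⁰` in the printed model** (BIJL 2018, §6: "this set has a `VNP⁰`-natural proof,
namely the permanent itself"; cf. the tree's `isVNP0Family_perPoly`).
[cite: BlaserIkenmeyerJindalLysikov2018, §6 (p. 17) and Def. 29] [cite: Burgisser2006, Def. 2.8] -/
theorem isExactVNP0Family_perPoly :
    IsExactVNP0Family (σ := fun n => Fin n × Fin n) fun n => perPoly (Fin n) ℤ :=
  ⟨fun n => n, fun n => perVNPWitness n ℤ, isExactVP0Family_perVNPWitness,
    fun n => (boolSum_perVNPWitness n ℤ).symm⟩

/-- **The Hamiltonian-cycle witness family is in printed `VP⁰`** (cf. `isVP0Family_hcVNPFamily`).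
[cite: Burgisser2006, Def. 2.7] [cite: BurgisserClausenShokrollahi1997, Prop. (21.15)] -/
theorem isExactVP0Family_hcVNPFamily :
    IsExactVP0Family (σ := fun n => (Fin n × Fin n) ⊕ Fin (n * n)) (hcVNPFamily ℤ) := by
  refine IsExactVP0Family.of_hasTauDeg₁ ?_ (s := fun n => 9 * n ^ 4) (d := fun n => 3 * n ^ 4 + 1)
    ?_ ?_ hasTauDeg₁_hcVNPFamily
  · refine (IsPBounded.iff_exists_le_mul_succ_pow _).2 ⟨2, 2, fun n => ?_⟩
    simp only [Fintype.card_sum, Fintype.card_prod, Fintype.card_fin]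
    nlinarith
  · refine (IsPBounded.iff_exists_le_mul_succ_pow _).2 ⟨9, 4, fun n => ?_⟩
    exact Nat.mul_le_mul_left _ (Nat.pow_le_pow_left (Nat.le_succ n) 4)
  · refine (IsPBounded.iff_exists_le_mul_succ_pow _).2 ⟨4, 4, fun n => ?_⟩
    have : n ^ 4 ≤ (n + 1) ^ 4 := Nat.pow_le_pow_left (Nat.le_succ n) 4
    have : 1 ≤ (n + 1) ^ 4 := Nat.one_le_pow _ _ (Nat.succ_pos n)
    show 3 * n ^ 4 + 1 ≤ 4 * (n + 1) ^ 4
    omega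

/-- **`HC ∈ VNP⁰` in the printed model** (cf. `isVNP0Family_hcPoly`). [cite: Tavenas2014, §1.3 (p. 18)]
[cite: Burgisser2006, Def. 2.8] -/
theorem isExactVNP0Family_hcPoly :
    IsExactVNP0Family (σ := fun n => Fin n × Fin n) fun n => hcPoly (Fin n) ℤ :=
  ⟨fun n => n * n, hcVNPFamily ℤ, isExactVP0Family_hcVNPFamily,
    fun n => (boolSum_hcVNPFamily ℤ n).symm⟩

/-- **`DET ∈ VP⁰` in the printed model** (via the Mahajan–Vinay skew circuits,
`isVPsZeroFamily_detPoly`, and `pad₀`; cf. `isVP0Family_detPoly`). [cite: MahajanVinay1997, §3 Thm 2]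
[cite: Burgisser2006, Def. 2.7] -/
theorem isExactVP0Family_detPoly : IsExactVP0Family (fun n => detPoly (Fin n) ℤ) := by
  refine isVPsZeroFamily_detPoly.isExactVP0Family ?_
  refine ⟨2, fun n => ?_⟩
  simp only [Fintype.card_prod, Fintype.card_fin]
  nlinarith

end Memberships

end Literature.Computability.AlgebraicComplexity
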